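import Summits.NavierStokesRegularity.FunctionalMining.StretchingLowerCellularCells
import Literature.Analysis.FunctionSpaces.TorusEnstrophyOrthogonality
import HarnessLib

/-!
# K1-Q1 lower side in the kernel: cellular fields, part 4 — production and enstrophy of the cellular field

Cell `pub-nsfunc`, prove seat gen 5, on `pub-nsfunc-bank/K1Q1-HALF.md` Thm 1. **Search for candidate a priori estimates; no regularity claim.** Static field facts only; nothing is
asserted about Navier–Stokes solutions or their regularity.

This file: `σ(u) = ∫_{T²} (Q'(y₀) − Q'(y₁))∂₀w∂₁w` (orthogonality form of the production,
`Torus.integral_inner_laplacian_convect_self_eq_neg`, and the planar lift), `ℰ(u) = ½∫_{T²}(Q'(y₀)² + Q'(y₁)² + |∇w|²)`;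
for the concrete profiles: `‖ω‖∞² ≤ max 4 (2(|a| + L|a/m|)²)`, `σ ≥ ∫mainTerm − K`, `2ℰ ≤ 2∫₀¹S_ε'² + ∫mainTerm + K`,
and `4a²(ι² − s) ≤ ∫ mainTerm ≤ 4a²ι²` with `ι = ∫₀¹η₋²` and the slack `s = ∫₀¹(1 − w_ε²) ≤ 4ε`.
-/

noncomputable section

open MeasureTheory Set Filter Topology Function
open scoped InnerProductSpace ContDiff

namespace Summit.NavierStokesRegularity.FunctionalMining

open Literature.Analysis Literature.Analysis.FunctionSpaces Literature.Analysis.FunctionSpaces.Torus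
open Literature.Analysis.FluidPDE Literature.Analysis.FluidPDE.Torus

namespace CellularStretching

/-! ## 8. `σ(u) = ∫ dens`, `ℰ(u) = ½∫ gradSq`, and their bounds -/

section Assembly

variable (Q N H : ShearProfile)

/-- Continuity bookkeeping: `y ↦ P(y_j)`. [folklore] -/
theorem continuous_onCircle_coord (P : ShearProfile) (j : Fin 2) :
    Continuous fun y : UnitAddTorus (Fin 2) => P.onCircle (y j) :=
  P.continuous_onCircle.comp (continuous_apply j)

/-- Continuity bookkeeping: `y ↦ P(y₀ + y₁)`. [folklore] -/
theorem continuous_onCircle_add (P : ShearProfile) :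
    Continuous fun y : UnitAddTorus (Fin 2) => P.onCircle (y 0 + y 1) :=
  P.continuous_onCircle.comp ((continuous_apply 0).add (continuous_apply 1))

/-- Continuity bookkeeping: `y ↦ P(y₀ − y₁)`. [folklore] -/
theorem continuous_onCircle_sub (P : ShearProfile) :
    Continuous fun y : UnitAddTorus (Fin 2) => P.onCircle (y 0 - y 1) :=
  P.continuous_onCircle.comp ((continuous_apply 0).sub (continuous_apply 1))

/-- Continuity bookkeeping: `∂_r w`. [folklore] -/
theorem continuous_partialDeriv_w (r : Fin 2) : Continuous (Torus.partialDeriv r (w N H)) :=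
  ((isSmooth_w N H).partialDeriv r).continuous

/-- Continuity of the production density. [folklore] -/
theorem continuous_dens : Continuous (dens Q N H) := by
  unfold dens
  exact (((continuous_onCircle_coord Q.D 0).sub (continuous_onCircle_coord Q.D 1)).mul
    (continuous_partialDeriv_w N H 0)).mul (continuous_partialDeriv_w N H 1)

/-- Continuity of the gradient density. [folklore] -/
theorem continuous_gradSq : Continuous (gradSq Q N H) := by
  unfold gradSq
  exact (((continuous_onCircle_coord Q.D 0).pow 2).add ((continuous_onCircle_coord Q.D 1).pow 2)).add
    (((continuous_partialDeriv_w N H 0).pow 2).add ((continuous_partialDeriv_w N H 1).pow 2))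

/-- Continuity of the main term. [folklore] -/
theorem continuous_mainTerm : Continuous (mainTerm N H) := by
  unfold mainTerm
  exact ((continuous_const.mul (((continuous_onCircle_coord (shift N 2⁻¹) 0).mul
    (continuous_onCircle_coord N 1)).pow 2)).mul ((continuous_onCircle_add H.D).pow 2)).add
    ((continuous_const.mul (((continuous_onCircle_coord N 0).mul
    (continuous_onCircle_coord (shift N 2⁻¹) 1)).pow 2)).mul ((continuous_onCircle_sub H.D).pow 2))

/-- **`σ(u) = ∫_{T²} (Q'(y₀) − Q'(y₁))∂₀w∂₁w dy`** (orthogonality form of the production + planar lift).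
[ours] -/
theorem enstrophyProduction_u : enstrophyProduction (u Q N H) = ∫ y, dens Q N H y := by
  have hcomm : enstrophyProduction (u Q N H) =
      ∫ x, ⟪Torus.laplacian (u Q N H) x, Torus.convect (u Q N H) (u Q N H) x⟫_ℝ := by
    unfold enstrophyProduction
    exact congrArg (fun f : UnitAddTorus (Fin 3) → ℝ => ∫ x, f x)
      (funext fun x => real_inner_comm (Torus.laplacian (u Q N H) x) (Torus.convect (u Q N H) (u Q N H) x))
  rw [hcomm, Torus.integral_inner_laplacian_convect_self_eq_neg (isSmooth_u Q N H) (isDivFree_u Q N H),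
    ← integral_neg]
  have hpt : (fun x => -∑ m, ∑ i, Torus.partialDeriv m (u Q N H) x i *
      ⟪Torus.partialDeriv m (u Q N H) x, Torus.partialDeriv i (u Q N H) x⟫_ℝ) =
      fun x => dens Q N H (planarProj x) := by
    funext x
    rw [orthForm_u, dens, planarProj_apply, planarProj_apply]
    simp only [Fin.castSucc_zero, Fin.castSucc_one]
    ring
  rw [hpt, integral_comp_planarProj (continuous_dens Q N H).aestronglyMeasurable]

/-- **`ℰ(u) = ½∫_{T²} (Q'(y₀)² + Q'(y₁)² + |∇w|²) dy`.** [ours] -/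
theorem torusEnstrophy_u : torusEnstrophy (u Q N H) = 2⁻¹ * ∫ y, gradSq Q N H y := by
  rw [torusEnstrophy, Torus.gradNormSq]
  have hpt : (fun x => ∑ i, ‖Torus.partialDeriv i (u Q N H) x‖ ^ 2) = fun x => gradSq Q N H (planarProj x) := by
    funext x
    rw [sum_norm_sq_partialDeriv_u, gradSq, planarProj_apply, planarProj_apply]
    simp only [Fin.castSucc_zero, Fin.castSucc_one]
    ring
  rw [hpt, integral_comp_planarProj (continuous_gradSq Q N H).aestronglyMeasurable]

end Assembly

section Bounds

variable {ε : ℝ} (hε : 0 < ε) (hε' : ε ≤ 1 / 32) (m : ℕ) (a : ℝ)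

/-- **`‖ω‖∞² ≤ max 4 (2(|a| + L|a/m|)²)`** for the cellular field. [ours] -/
theorem torusVorticitySqAt_cell_le (x : UnitAddTorus (Fin 3)) :
    torusVorticitySqAt (u (base hε hε') (envM hε hε') (wave hε hε' m a)) x ≤
      max 4 (2 * (|a| + envLip ε * |a / m|) ^ 2) := by
  rw [torusVorticitySqAt_u]
  exact (pointwise_cell hε hε' m a (planarProj x)).2.2

/-- **`σ(u) ≥ ∫ mainTerm − K`.** [ours] -/
theorem integral_mainTerm_sub_le_production :
    (∫ y, mainTerm (envM hε hε') (wave hε hε' m a) y) - Kc ε m a ≤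
      enstrophyProduction (u (base hε hε') (envM hε hε') (wave hε hε' m a)) := by
  rw [enstrophyProduction_u]
  have hi1 : Integrable (fun y => mainTerm (envM hε hε') (wave hε hε' m a) y - Kc ε m a) volume :=
    ((continuous_mainTerm _ _).sub continuous_const).integrable_unitAddTorus
  have hi2 : Integrable (dens (base hε hε') (envM hε hε') (wave hε hε' m a)) volume :=
    (continuous_dens _ _ _).integrable_unitAddTorus
  have hmono := integral_mono hi1 hi2 fun y => (pointwise_cell hε hε' m a y).1
  rw [integral_sub (continuous_mainTerm _ _).integrable_unitAddTorus (integrable_const _), integral_const] at hmono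
  simpa using hmono

/-- The mean square `∫₀¹ P'²` of the derivative of a profile. [ours; bookkeeping] -/
def msqD (P : ShearProfile) : ℝ := ∫ t in (0 : ℝ)..1, deriv P t ^ 2

/-- `∫_{T²} P'(y_j)² dy = ∫₀¹ P'²`. [folklore] -/
theorem integral_sq_D_coord (P : ShearProfile) (j : Fin 2) :
    ∫ y : UnitAddTorus (Fin 2), P.D.onCircle (y j) ^ 2 = msqD P := by
  fin_cases j
  · have h := integral_mul_coord (fun b => P.D.onCircle b ^ 2) (fun _ => (1 : ℝ))
    simp only [mul_one] at h
    rw [show ((fun y : UnitAddTorus (Fin 2) => P.D.onCircle (y 0) ^ 2)) =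
      fun y => P.D.onCircle (y ((fun i => i) ⟨0, by norm_num⟩)) ^ 2 from rfl] at h
    rw [h, integral_circle_const_one, mul_one, integral_circle_eq_intervalIntegral]
    simp [msqD, ShearProfile.D_apply]
  · have h := integral_mul_coord (fun _ => (1 : ℝ)) (fun b => P.D.onCircle b ^ 2)
    simp only [one_mul] at h
    rw [show ((fun y : UnitAddTorus (Fin 2) => P.D.onCircle (y 1) ^ 2)) =
      fun y => P.D.onCircle (y ((fun i => i) ⟨1, by norm_num⟩)) ^ 2 from rfl] at h
    rw [h, integral_circle_const_one, one_mul, integral_circle_eq_intervalIntegral]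
    simp [msqD, ShearProfile.D_apply]

/-- **`2ℰ(u) ≤ 2∫₀¹Q'² + ∫ mainTerm + K`.** [ours] -/
theorem two_mul_torusEnstrophy_le :
    2 * torusEnstrophy (u (base hε hε') (envM hε hε') (wave hε hε' m a)) ≤
      2 * msqD (base hε hε') + (∫ y, mainTerm (envM hε hε') (wave hε hε' m a) y) + Kc ε m a := by
  rw [torusEnstrophy_u]
  have hpt : ∀ y, gradSq (base hε hε') (envM hε hε') (wave hε hε' m a) y ≤
      ((base hε hε').D.onCircle (y 0) ^ 2 + (base hε hε').D.onCircle (y 1) ^ 2) +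
        (mainTerm (envM hε hε') (wave hε hε' m a) y + Kc ε m a) := fun y => by
    unfold gradSq
    linarith only [(pointwise_cell hε hε' m a y).2.1]
  have hi1 : Integrable (gradSq (base hε hε') (envM hε hε') (wave hε hε' m a)) volume :=
    (continuous_gradSq _ _ _).integrable_unitAddTorus
  have hc0 : Continuous fun y : UnitAddTorus (Fin 2) => (base hε hε').D.onCircle (y 0) ^ 2 :=
    (continuous_onCircle_coord (base hε hε').D 0).pow 2
  have hc1 : Continuous fun y : UnitAddTorus (Fin 2) => (base hε hε').D.onCircle (y 1) ^ 2 :=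
    (continuous_onCircle_coord (base hε hε').D 1).pow 2
  have hcm : Continuous fun y : UnitAddTorus (Fin 2) => mainTerm (envM hε hε') (wave hε hε' m a) y + Kc ε m a :=
    (continuous_mainTerm _ _).add continuous_const
  have hi2 : Integrable (fun y => ((base hε hε').D.onCircle (y 0) ^ 2 + (base hε hε').D.onCircle (y 1) ^ 2) +
      (mainTerm (envM hε hε') (wave hε hε' m a) y + Kc ε m a)) volume :=
    ((hc0.add hc1).add hcm).integrable_unitAddTorus
  have hmono := integral_mono hi1 hi2 hpt
  have i01 : Integrable (fun y : UnitAddTorus (Fin 2) =>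
      (base hε hε').D.onCircle (y 0) ^ 2 + (base hε hε').D.onCircle (y 1) ^ 2) volume :=
    (hc0.add hc1).integrable_unitAddTorus
  have i0 : Integrable (fun y : UnitAddTorus (Fin 2) => (base hε hε').D.onCircle (y 0) ^ 2) volume :=
    hc0.integrable_unitAddTorus
  have i1 : Integrable (fun y : UnitAddTorus (Fin 2) => (base hε hε').D.onCircle (y 1) ^ 2) volume :=
    hc1.integrable_unitAddTorus
  have im : Integrable (mainTerm (envM hε hε') (wave hε hε' m a)) volume :=
    (continuous_mainTerm _ _).integrable_unitAddTorus
  have imk : Integrable (fun y : UnitAddTorus (Fin 2) => mainTerm (envM hε hε') (wave hε hε' m a) y + Kc ε m a)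
      volume := hcm.integrable_unitAddTorus
  have hK : ∫ _y : UnitAddTorus (Fin 2), Kc ε m a = Kc ε m a := by simp
  rw [integral_add i01 imk, integral_add i0 i1, integral_add im (integrable_const _), hK,
    integral_sq_D_coord, integral_sq_D_coord] at hmono
  linarith

end Bounds

/-! ## 9. The integral of the main term: `4a²(ι² − s) ≤ ∫ mainTerm ≤ 4a²ι²` -/

/-- Mean square of a shifted profile over a period equals that of the profile. [folklore] -/
theorem intervalIntegral_sq_shift (P : ShearProfile) (c : ℝ) :
    ∫ t in (0 : ℝ)..1, shift P c t ^ 2 = ∫ t in (0 : ℝ)..1, P t ^ 2 := by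
  simp only [shift_apply]
  rw [intervalIntegral.integral_comp_add_right (fun t => P t ^ 2) c, zero_add]
  have hper : Function.Periodic (fun t => P t ^ 2) 1 := fun t => by simp [P.periodic t]
  have := hper.intervalIntegral_add_eq c 0
  rw [zero_add] at this
  rw [show (1 : ℝ) + c = c + 1 by ring, this]

/-- `∫_T (P.onCircle b)² db = ∫₀¹ P²`. [folklore] -/
theorem integral_sq_onCircle (P : ShearProfile) : ∫ b, P.onCircle b ^ 2 = ∫ t in (0 : ℝ)..1, P t ^ 2 := by
  rw [integral_circle_eq_intervalIntegral]; simp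

/-- **The mean square of the envelope**: `ι = ∫₀¹ η₋²`. [ours; bookkeeping] -/
def envMsq (P : ShearProfile) : ℝ := ∫ t in (0 : ℝ)..1, P t ^ 2

/-- `∫_{T²} E_A² = ι²` (`E_A(y) = η₊(y₀)η₋(y₁)`, `∫η₊² = ∫η₋² = ι`). [ours; elementary] -/
theorem integral_EA_sq (N : ShearProfile) :
    ∫ y : UnitAddTorus (Fin 2), ((shift N 2⁻¹).onCircle (y 0) * N.onCircle (y 1)) ^ 2 = envMsq N ^ 2 := by
  have h := integral_mul_coord (fun b => (shift N 2⁻¹).onCircle b ^ 2) (fun b => N.onCircle b ^ 2)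
  simp only [← mul_pow] at h
  rw [h, integral_sq_onCircle, integral_sq_onCircle, intervalIntegral_sq_shift, envMsq, sq]

/-- `∫_{T²} E_B² = ι²`. [ours; elementary] -/
theorem integral_EB_sq (N : ShearProfile) :
    ∫ y : UnitAddTorus (Fin 2), (N.onCircle (y 0) * (shift N 2⁻¹).onCircle (y 1)) ^ 2 = envMsq N ^ 2 := by
  have h := integral_mul_coord (fun b => N.onCircle b ^ 2) (fun b => (shift N 2⁻¹).onCircle b ^ 2)
  simp only [← mul_pow] at h
  rw [h, integral_sq_onCircle, integral_sq_onCircle, intervalIntegral_sq_shift, envMsq, sq]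

section MainTerm

variable {ε : ℝ} (hε : 0 < ε) (hε' : ε ≤ 1 / 32) (m : ℕ) (a : ℝ)

/-- **`∫ mainTerm ≤ 4a²ι²`** (`H'² ≤ a²`). [ours] -/
theorem integral_mainTerm_le :
    ∫ y, mainTerm (envM hε hε') (wave hε hε' m a) y ≤ 4 * a ^ 2 * envMsq (envM hε hε') ^ 2 := by
  set N := envM hε hε'
  have hsq : ∀ b, (wave hε hε' m a).D.onCircle b ^ 2 ≤ a ^ 2 := fun b => by
    have h := abs_waveD_le hε hε' m a b
    have := pow_le_pow_left₀ (abs_nonneg _) h 2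
    simpa only [sq_abs] using this
  have hpt : ∀ y : UnitAddTorus (Fin 2), mainTerm N (wave hε hε' m a) y ≤
      2 * a ^ 2 * ((shift N 2⁻¹).onCircle (y 0) * N.onCircle (y 1)) ^ 2 +
        2 * a ^ 2 * (N.onCircle (y 0) * (shift N 2⁻¹).onCircle (y 1)) ^ 2 := fun y => by
    unfold mainTerm
    have h1 := hsq (y 0 + y 1); have h2 := hsq (y 0 - y 1)
    have p1 := sq_nonneg ((shift N 2⁻¹).onCircle (y 0) * N.onCircle (y 1))
    have p2 := sq_nonneg (N.onCircle (y 0) * (shift N 2⁻¹).onCircle (y 1))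
    nlinarith [mul_le_mul_of_nonneg_left h1 p1, mul_le_mul_of_nonneg_left h2 p2]
  have hcA : Continuous fun y : UnitAddTorus (Fin 2) =>
      2 * a ^ 2 * ((shift N 2⁻¹).onCircle (y 0) * N.onCircle (y 1)) ^ 2 :=
    continuous_const.mul (((continuous_onCircle_coord (shift N 2⁻¹) 0).mul (continuous_onCircle_coord N 1)).pow 2)
  have hcB : Continuous fun y : UnitAddTorus (Fin 2) =>
      2 * a ^ 2 * (N.onCircle (y 0) * (shift N 2⁻¹).onCircle (y 1)) ^ 2 :=
    continuous_const.mul (((continuous_onCircle_coord N 0).mul (continuous_onCircle_coord (shift N 2⁻¹) 1)).pow 2)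
  have hiA : Integrable (fun y : UnitAddTorus (Fin 2) =>
      2 * a ^ 2 * ((shift N 2⁻¹).onCircle (y 0) * N.onCircle (y 1)) ^ 2) volume := hcA.integrable_unitAddTorus
  have hiB : Integrable (fun y : UnitAddTorus (Fin 2) =>
      2 * a ^ 2 * (N.onCircle (y 0) * (shift N 2⁻¹).onCircle (y 1)) ^ 2) volume := hcB.integrable_unitAddTorus
  have hiAB : Integrable (fun y : UnitAddTorus (Fin 2) =>
      2 * a ^ 2 * ((shift N 2⁻¹).onCircle (y 0) * N.onCircle (y 1)) ^ 2 +
        2 * a ^ 2 * (N.onCircle (y 0) * (shift N 2⁻¹).onCircle (y 1)) ^ 2) volume :=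
    (hcA.add hcB).integrable_unitAddTorus
  have hmono := integral_mono (continuous_mainTerm N _).integrable_unitAddTorus hiAB hpt
  rw [integral_add hiA hiB, integral_const_mul, integral_const_mul, integral_EA_sq, integral_EB_sq] at hmono
  linarith

/-- **The slack** `s = ∫₀¹ (1 − w_ε²) ∈ [0, 4ε]`. [ours; bookkeeping] -/
def slack (ε : ℝ) : ℝ := ∫ t in (0 : ℝ)..1, (1 - DEIJ.slopeWave ε t ^ 2)

include hε hε' in
/-- `0 ≤ s ≤ 4ε`. [folklore] -/
theorem slack_mem : slack ε ∈ Icc 0 (4 * ε) :=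
  ⟨intervalIntegral.integral_nonneg zero_le_one fun t _ =>
      (DEIJ.one_sub_slopeWave_sq_mem hε (le_sixteenth hε') t).1,
    DEIJ.intervalIntegral_one_sub_slopeWave_sq_le hε (le_sixteenth hε')⟩

/-- `H' = a · S_ε'(m·)` on the circle (`m ≠ 0`). [ours; elementary] -/
theorem waveD_onCircle {m : ℕ} (hm : m ≠ 0) (b : UnitAddCircle) :
    (wave hε hε' m a).D.onCircle b = a * (base hε hε').D.onCircle (m • b) := by
  obtain ⟨t, rfl⟩ := QuotientAddGroup.mk_surjective b
  have hn : (m • ((t : ℝ) : UnitAddCircle)) = (((m : ℝ) * t : ℝ) : UnitAddCircle) := by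
    rw [← AddCircle.coe_nsmul, nsmul_eq_mul]
  rw [hn, ShearProfile.onCircle_coe, ShearProfile.onCircle_coe, ShearProfile.D_apply, ShearProfile.D_apply,
    deriv_wave hε hε' hm, deriv_base]

/-- The slack function `b ↦ 1 − S_ε'(m•b)²` is continuous. [folklore] -/
theorem continuous_slackFun (m : ℕ) :
    Continuous fun b : UnitAddCircle => 1 - (base hε hε').D.onCircle (m • b) ^ 2 :=
  continuous_const.sub (((base hε hε').D.continuous_onCircle.comp (continuous_nsmul m)).pow 2)

/-- `∫_T (1 − S_ε'(m•b)²) db = s` (`0 < m`). [ours; elementary] -/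
theorem integral_slackFun {m : ℕ} (hm : 0 < m) :
    ∫ b : UnitAddCircle, (1 - (base hε hε').D.onCircle (m • b) ^ 2) = slack ε := by
  rw [integral_comp_nsmul_circle (g := fun b => 1 - (base hε hε').D.onCircle b ^ 2)
    (continuous_const.sub ((base hε hε').D.continuous_onCircle.pow 2)) hm,
    integral_circle_eq_intervalIntegral]
  simp [slack, ShearProfile.D_apply, deriv_base]

/-- **`4a²(ι² − s) ≤ ∫ mainTerm`** (`0 < m`): `H'² = a² − a²(1 − w_ε(m·)²)`, `E² ≤ 1`, shear and dilation
invariance of the slack integrals. [ours] -/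
theorem le_integral_mainTerm {m : ℕ} (hm : 0 < m) :
    4 * a ^ 2 * (envMsq (envM hε hε') ^ 2 - slack ε) ≤
      ∫ y, mainTerm (envM hε hε') (wave hε hε' m a) y := by
  set N := envM hε hε'
  set Q := base hε hε'
  have hm' : m ≠ 0 := hm.ne'
  -- pointwise
  have hpt : ∀ y : UnitAddTorus (Fin 2),
      2 * a ^ 2 * ((shift N 2⁻¹).onCircle (y 0) * N.onCircle (y 1)) ^ 2 +
        2 * a ^ 2 * (N.onCircle (y 0) * (shift N 2⁻¹).onCircle (y 1)) ^ 2 -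
        (2 * a ^ 2 * (1 - Q.D.onCircle (m • (y 0 + y 1)) ^ 2) +
          2 * a ^ 2 * (1 - Q.D.onCircle (m • (y 0 - y 1)) ^ 2)) ≤
      mainTerm N (wave hε hε' m a) y := fun y => by
    unfold mainTerm
    rw [waveD_onCircle hε hε' a hm', waveD_onCircle hε hε' a hm']
    have hA := envP_onCircle_mem hε hε' (y 0); have hB := envM_onCircle_mem hε hε' (y 1)
    have hC := envM_onCircle_mem hε hε' (y 0); have hD := envP_onCircle_mem hε hε' (y 1)
    have hP1 : ((shift N 2⁻¹).onCircle (y 0) * N.onCircle (y 1)) ^ 2 ≤ 1 := by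
      rw [mul_pow]; exact mul_le_one₀ (pow_le_one₀ hA.1 hA.2) (sq_nonneg _) (pow_le_one₀ hB.1 hB.2)
    have hP2 : (N.onCircle (y 0) * (shift N 2⁻¹).onCircle (y 1)) ^ 2 ≤ 1 := by
      rw [mul_pow]; exact mul_le_one₀ (pow_le_one₀ hC.1 hC.2) (sq_nonneg _) (pow_le_one₀ hD.1 hD.2)
    have hq1 : Q.D.onCircle (m • (y 0 + y 1)) ^ 2 ≤ 1 := by
      have h := abs_baseD_le hε hε' (m • (y 0 + y 1))
      have := pow_le_pow_left₀ (abs_nonneg _) h 2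
      simpa only [sq_abs, one_pow] using this
    have hq2 : Q.D.onCircle (m • (y 0 - y 1)) ^ 2 ≤ 1 := by
      have h := abs_baseD_le hε hε' (m • (y 0 - y 1))
      have := pow_le_pow_left₀ (abs_nonneg _) h 2
      simpa only [sq_abs, one_pow] using this
    have ha2 : 0 ≤ a ^ 2 := sq_nonneg a
    nlinarith [mul_nonneg ha2 (mul_nonneg (sub_nonneg.2 hP1) (sub_nonneg.2 hq1)),
      mul_nonneg ha2 (mul_nonneg (sub_nonneg.2 hP2) (sub_nonneg.2 hq2))]
  -- integrate
  have hcA : Continuous fun y : UnitAddTorus (Fin 2) =>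
      2 * a ^ 2 * ((shift N 2⁻¹).onCircle (y 0) * N.onCircle (y 1)) ^ 2 :=
    continuous_const.mul (((continuous_onCircle_coord (shift N 2⁻¹) 0).mul (continuous_onCircle_coord N 1)).pow 2)
  have hcB : Continuous fun y : UnitAddTorus (Fin 2) =>
      2 * a ^ 2 * (N.onCircle (y 0) * (shift N 2⁻¹).onCircle (y 1)) ^ 2 :=
    continuous_const.mul (((continuous_onCircle_coord N 0).mul (continuous_onCircle_coord (shift N 2⁻¹) 1)).pow 2)
  have hcs : Continuous fun b : UnitAddCircle => 1 - Q.D.onCircle (m • b) ^ 2 := continuous_slackFun hε hε' m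
  have hcC : Continuous fun y : UnitAddTorus (Fin 2) => 2 * a ^ 2 * (1 - Q.D.onCircle (m • (y 0 + y 1)) ^ 2) :=
    continuous_const.mul (hcs.comp ((continuous_apply 0).add (continuous_apply 1)))
  have hcD : Continuous fun y : UnitAddTorus (Fin 2) => 2 * a ^ 2 * (1 - Q.D.onCircle (m • (y 0 - y 1)) ^ 2) :=
    continuous_const.mul (hcs.comp ((continuous_apply 0).sub (continuous_apply 1)))
  have hiA : Integrable (fun y : UnitAddTorus (Fin 2) =>
      2 * a ^ 2 * ((shift N 2⁻¹).onCircle (y 0) * N.onCircle (y 1)) ^ 2) volume := hcA.integrable_unitAddTorus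
  have hiB : Integrable (fun y : UnitAddTorus (Fin 2) =>
      2 * a ^ 2 * (N.onCircle (y 0) * (shift N 2⁻¹).onCircle (y 1)) ^ 2) volume := hcB.integrable_unitAddTorus
  have hiC : Integrable (fun y : UnitAddTorus (Fin 2) =>
      2 * a ^ 2 * (1 - Q.D.onCircle (m • (y 0 + y 1)) ^ 2)) volume := hcC.integrable_unitAddTorus
  have hiD : Integrable (fun y : UnitAddTorus (Fin 2) =>
      2 * a ^ 2 * (1 - Q.D.onCircle (m • (y 0 - y 1)) ^ 2)) volume := hcD.integrable_unitAddTorus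
  have hiAB : Integrable (fun y : UnitAddTorus (Fin 2) =>
      2 * a ^ 2 * ((shift N 2⁻¹).onCircle (y 0) * N.onCircle (y 1)) ^ 2 +
        2 * a ^ 2 * (N.onCircle (y 0) * (shift N 2⁻¹).onCircle (y 1)) ^ 2) volume :=
    (hcA.add hcB).integrable_unitAddTorus
  have hiCD : Integrable (fun y : UnitAddTorus (Fin 2) =>
      2 * a ^ 2 * (1 - Q.D.onCircle (m • (y 0 + y 1)) ^ 2) +
        2 * a ^ 2 * (1 - Q.D.onCircle (m • (y 0 - y 1)) ^ 2)) volume :=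
    (hcC.add hcD).integrable_unitAddTorus
  have hiall : Integrable (fun y : UnitAddTorus (Fin 2) =>
      2 * a ^ 2 * ((shift N 2⁻¹).onCircle (y 0) * N.onCircle (y 1)) ^ 2 +
        2 * a ^ 2 * (N.onCircle (y 0) * (shift N 2⁻¹).onCircle (y 1)) ^ 2 -
        (2 * a ^ 2 * (1 - Q.D.onCircle (m • (y 0 + y 1)) ^ 2) +
          2 * a ^ 2 * (1 - Q.D.onCircle (m • (y 0 - y 1)) ^ 2))) volume :=
    ((hcA.add hcB).sub (hcC.add hcD)).integrable_unitAddTorus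
  have hmono := integral_mono hiall (continuous_mainTerm N _).integrable_unitAddTorus hpt
  have hslackP : ∫ y : UnitAddTorus (Fin 2), 2 * a ^ 2 * (1 - Q.D.onCircle (m • (y 0 + y 1)) ^ 2) =
      2 * a ^ 2 * slack ε := by
    rw [integral_const_mul, integral_comp_add_coord (g := fun b => 1 - Q.D.onCircle (m • b) ^ 2) hcs,
      integral_slackFun hε hε' hm]
  have hslackM : ∫ y : UnitAddTorus (Fin 2), 2 * a ^ 2 * (1 - Q.D.onCircle (m • (y 0 - y 1)) ^ 2) =
      2 * a ^ 2 * slack ε := by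
    rw [integral_const_mul, integral_comp_sub_coord (g := fun b => 1 - Q.D.onCircle (m • b) ^ 2) hcs,
      integral_slackFun hε hε' hm]
  rw [integral_sub hiAB hiCD, integral_add hiA hiB, integral_add hiC hiD, integral_const_mul,
    integral_const_mul, integral_EA_sq, integral_EB_sq, hslackP, hslackM] at hmono
  linarith

end MainTerm

end CellularStretching

end Summit.NavierStokesRegularity.FunctionalMining

end
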